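import Summits.QuantumFields.YangMills.Theorems.UnitScaleTiltProp7SymAvgTwOfRegPr
import Summits.QuantumFields.YangMills.Theorems.UnitScaleTiltProp7QSymCovCandidateOfRegPr
import Summits.QuantumFields.YangMills.Theorems.UnitScaleTiltProp7SymAvgTwCovConstExt
import HarnessLib

/-!
# Prop 7, route `UnitScaleTilt`: the right inverse of the TWISTED symmetric linearised average `QTw U₀` at a printed-regular background — ALL ROWS DISCHARGED

The final `RegPr`-level knit of the Σ-twist programme (OWNER RULING g26-№1, W-SEAT MAP 3 row ★w3-20520 (o-1)): for a member `(F, n, K)` of a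
`T3Family`, `n < K`, and a printed-regular background `U₀ ∈ 𝔘_k(ε₀)` (`RegPr F n K ε₀ U₀`, [Balaban1985Variational] (7) p.278), the route's
twisted symmetric linearised average `QTw F n K h U₀` ([Balaban1985Variational] (44) p.285 in the axial chart of [Balaban1985BackgroundPropagators]
(1.19) p.98) has an EXACT `ℂ`-linear right inverse `H'` with a `k`-UNIFORM sup-norm bound ([Balaban1985Variational] (45)–(46) p.285):

* `H` — the right inverse of the UNtwisted `QSym U₀` (`Prop7QSymCovCandidate.exists_rightInv_QSym_of_regPr`: covariant one-block candidate + Neumann step,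
  `‖H‖ ≤ 2·1056∕L^{K−n}`, windows `4L^{K−n} ≤ |T⁽⁰⁾|`, `13·10¹⁴L³ε₀ ≤ 1`);
* `ȟ` — the covariantly-constant extension of a top-lattice `su(2)`-datum down the tower of averages of `U₀` (`Prop7SymAvgTwCovConstExt.exists_covConstExt`:
  centre row, axial gauge (1.19) along `t ↦ exp(t·ȟη)·U₀` for every `t`, `‖∂_{U₀} ȟη‖ ≤ 2‖η‖`), [Balaban1985BackgroundPropagators] (1.19)–(1.22) pp.98–99;
* the capstone `Prop7SymAvgTwOfRegPr.exists_rightInv_QTw_of_regPr_WS` (★w5-20520 g3: bridge `QTw = QSym − D_{Ū₀}∘r`, gauge-direction identity, frame bound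
  `‖r‖ ≤ 8∕(eη)` by windows) assembling `H' := H + (t ↦ D_{Ū₀} ȟ) ∘ r ∘ H`-type correction (`Prop7TwistedRightInverse`).

Main results: `exists_rightInv_QTw_of_regPr` (bound `(1 + 2·8∕(eη))·(2·1056∕L^{K−n})`, `η = L^{−(K−n)}`) and `exists_rightInv_QTw_of_regPr_abs`
(the `k`-free form `‖H' X‖ ≤ (2112 + 33792∕e)·‖X‖`).  YM₃ on T³ is rung R3 of the programme, not the Clay problem.
-/

noncomputable section

open scoped Matrix.Norms.L2Operator Topology

namespace Summit.QuantumFields.YangMills.Theorems.Prop7QTwRightInverseOfRegPr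

open NormedSpace Filter
open Literature.MathematicalPhysics.QuantumFieldTheory.Balaban1983to89
open Literature.MathematicalPhysics.QuantumFieldTheory.Balaban1983to89.T3ContinuumYM3Torus
open T3PrintedRegularMinimiser (RegPr)
open T3SectALandauChart (pos_of_regPr eta)
open B7Prop2Explicit (C0 c2')
open Summit.QuantumFields.YangMills.Theorems.Prop7SymAvgTw (QTw)
open Summit.QuantumFields.YangMills.Theorems.Prop7QSymCovCandidate (exists_rightInv_QSym_of_regPr)
open Summit.QuantumFields.YangMills.Theorems.Prop7SymAvgTwCovConstExt (exists_covConstExt)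
open Summit.QuantumFields.YangMills.Theorems.Prop7SymAvgTwOfRegPr (exists_rightInv_QTw_of_regPr_WS)

variable (F : T3Family) {n K : ℕ} (h : n ≤ K)

/-- ★★★ **[Balaban1985Variational] (45)–(46) FOR THE TWISTED SYMMETRIC LINEARISED AVERAGE `QTw U₀` AT A `RegPr` BACKGROUND — ALL ROWS DISCHARGED.**
For `n < K`, `U₀ ∈ 𝔘_k(ε₀)`, the no-wrap margin `4L^{K−n} ≤ |T⁽⁰⁾|`, the `k`-uniform windows `13·10¹⁴L³ε₀ ≤ 1` (right inverse of `QSym`), the three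
`α₀ = 2ε₀` windows and the frame-bound windows in the auxiliary radius parameter `e > 0` (`exp(…)·(1 + 8C₁e) ≤ 2`, `2e ≤ c₃`, `2048·d·e ≤ 1`): there is a
`ℂ`-linear `H'` with `QTw F n K h U₀ (H' X) = X` for all `X` and `‖H' X‖ ≤ (1 + 2·(8∕(e·η)))·(2·1056∕L^{K−n})·‖X‖`, `η = L^{−(K−n)}` — the capstone
`exists_rightInv_QTw_of_regPr_WS` fed with `exists_rightInv_QSym_of_regPr` (`B_H = 2·1056∕L^{K−n}`) and `exists_covConstExt` (`C_Γ = 2`, axial row for every `t`).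
[cite: Balaban1985Variational, (44)-(46) p.285; Balaban1985BackgroundPropagators, (1.19)-(1.22) pp.98-99; Balaban1985Averaging, (11)-(13) p.19] -/
theorem exists_rightInv_QTw_of_regPr (hnK : n < K) {ε₀ e : ℝ} (he : 0 < e)
    (hα3 : C0 (F.P K).d * (2 * ε₀) ≤ 1 / 3) (hα4 : 4 * (2 * ε₀) ≤ c2' (F.P K).d (F.P K).L)
    (hsmall : Real.exp (4 * (800 * (((F.P K).d : ℝ) + 1) ^ 2 * (((F.P K).d : ℝ) + 4)) * (2 * ε₀))
      * (1 + 8 * (131072 * (((F.P K).d : ℝ) + 1) ^ 2) * e) ≤ 2)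
    (hc₃ : 2 * e ≤ B7Prop3Flat.c3 (F.P K).d (F.P K).L) (hsm : 2048 * ((F.P K).d : ℝ) * e ≤ 1)
    (U₀ : GaugeField (F.P K) 0 (Matrix.specialUnitaryGroup (Fin 2) ℂ)) (hreg : RegPr F n K ε₀ U₀)
    (hN4 : 4 * (F.P K).L ^ (K - n) ≤ (F.P K).sitesPerDir 0) (hwin : 13 * 10 ^ 14 * (F.L : ℝ) ^ 3 * ε₀ ≤ 1) :
    ∃ H' : (PBond (F.P n) 0 → Matrix (Fin 2) (Fin 2) ℂ) →ₗ[ℂ] (PBond (F.P K) 0 → Matrix (Fin 2) (Fin 2) ℂ),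
      (∀ X, QTw F n K h U₀ (H' X) = X) ∧
        ∀ X, ‖H' X‖ ≤ (1 + 2 * (8 / (e * eta F n K))) * (2 * (1056 / (F.L : ℝ) ^ (K - n))) * ‖X‖ := by
  have hε₀ : 0 < ε₀ := pos_of_regPr F hreg
  have hL1 : (1 : ℝ) ≤ F.L := by have := F.hL.2; exact_mod_cast (by omega : 1 ≤ F.L)
  have hL3 : (1 : ℝ) ≤ (F.L : ℝ) ^ 3 := one_le_pow₀ hL1
  have hx : 0 ≤ (F.L : ℝ) ^ 3 * ε₀ := by positivity
  have hε : 10 ^ 7 * (F.L : ℝ) ^ 3 * ε₀ ≤ 1 := by nlinarith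
  -- the right inverse of the untwisted `QSym U₀` ([Balaban1985Variational] (45)-(46) for `Q^{sym}`)
  obtain ⟨H, hH, hHb⟩ := exists_rightInv_QSym_of_regPr F h hnK hreg hN4 hwin
  -- the covariantly-constant extension `ȟ` ([Balaban1985BackgroundPropagators] (1.19))
  obtain ⟨hExt, hcentre, hax, hb⟩ := exists_covConstExt h hε₀ hα3 hα4 U₀ hreg
  exact exists_rightInv_QTw_of_regPr_WS F h hε₀ hε he hα3 hα4 hsmall hc₃ hsm U₀ hreg H hH hHb hExt hcentre
    (fun η => Filter.Eventually.of_forall (hax η)) (by norm_num : (0 : ℝ) ≤ 2) hb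

/-- **The `k`-free form of the bound**: under the hypotheses of `exists_rightInv_QTw_of_regPr`, `‖H' X‖ ≤ (2112 + 33792∕e)·‖X‖` — since `η·L^{K−n} = 1`
and `L^{K−n} ≥ 1`, `(1 + 16∕(eη))·(2112∕L^{K−n}) = 2112∕L^{K−n} + 33792∕e ≤ 2112 + 33792∕e`: the (46) bound UNIFORM in `k = K − n` (the uniformity the
inductive step of [Balaban1985Variational] §2 needs). [cite: Balaban1985Variational, (45)-(46) p.285] -/
theorem exists_rightInv_QTw_of_regPr_abs (hnK : n < K) {ε₀ e : ℝ} (he : 0 < e)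
    (hα3 : C0 (F.P K).d * (2 * ε₀) ≤ 1 / 3) (hα4 : 4 * (2 * ε₀) ≤ c2' (F.P K).d (F.P K).L)
    (hsmall : Real.exp (4 * (800 * (((F.P K).d : ℝ) + 1) ^ 2 * (((F.P K).d : ℝ) + 4)) * (2 * ε₀))
      * (1 + 8 * (131072 * (((F.P K).d : ℝ) + 1) ^ 2) * e) ≤ 2)
    (hc₃ : 2 * e ≤ B7Prop3Flat.c3 (F.P K).d (F.P K).L) (hsm : 2048 * ((F.P K).d : ℝ) * e ≤ 1)
    (U₀ : GaugeField (F.P K) 0 (Matrix.specialUnitaryGroup (Fin 2) ℂ)) (hreg : RegPr F n K ε₀ U₀)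
    (hN4 : 4 * (F.P K).L ^ (K - n) ≤ (F.P K).sitesPerDir 0) (hwin : 13 * 10 ^ 14 * (F.L : ℝ) ^ 3 * ε₀ ≤ 1) :
    ∃ H' : (PBond (F.P n) 0 → Matrix (Fin 2) (Fin 2) ℂ) →ₗ[ℂ] (PBond (F.P K) 0 → Matrix (Fin 2) (Fin 2) ℂ),
      (∀ X, QTw F n K h U₀ (H' X) = X) ∧ ∀ X, ‖H' X‖ ≤ (2112 + 33792 / e) * ‖X‖ := by
  obtain ⟨H', hH', hb⟩ := exists_rightInv_QTw_of_regPr F h hnK he hα3 hα4 hsmall hc₃ hsm U₀ hreg hN4 hwin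
  refine ⟨H', hH', fun X => (hb X).trans (mul_le_mul_of_nonneg_right ?_ (norm_nonneg X))⟩
  have hL1 : (1 : ℝ) ≤ F.L := by have := F.hL.2; exact_mod_cast (by omega : 1 ≤ F.L)
  have hL0 : (0 : ℝ) < F.L := by linarith
  have hLk1 : (1 : ℝ) ≤ (F.L : ℝ) ^ (K - n) := one_le_pow₀ hL1
  have hLk0 : (0 : ℝ) < (F.L : ℝ) ^ (K - n) := by positivity
  have hη : eta F n K = ((F.L : ℝ) ^ (K - n))⁻¹ := by
    show ((F.L : ℝ)⁻¹) ^ (K - n) = ((F.L : ℝ) ^ (K - n))⁻¹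
    exact inv_pow _ _
  have key : (1 + 2 * (8 / (e * eta F n K))) * (2 * (1056 / (F.L : ℝ) ^ (K - n)))
      = 2112 / (F.L : ℝ) ^ (K - n) + 33792 / e := by
    rw [hη]
    field_simp
    ring
  rw [key]
  have h1 : 2112 / (F.L : ℝ) ^ (K - n) ≤ 2112 := div_le_self (by norm_num) hLk1
  linarith

end Summit.QuantumFields.YangMills.Theorems.Prop7QTwRightInverseOfRegPr

end
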